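import Summits.HodgeConjecture.HodgeConjecture.Theorems.F0P3cStCharTSValueChecklist       -- ★ p850018 (LH6-p02 (g2)) the VALUE third `steinbergLabel_smoothTrace_sum_eq_cmXiTorusChar` (+ ★ HSt, ★ (L2) dictionary)
import Summits.HodgeConjecture.HodgeConjecture.Theorems.F0P3cStCharTSKappaRatio           -- ★ p850245 (LH6-p02 (g2)) `finTau_weylFlip` (`τ_v` at the flipped rep)
import Summits.HodgeConjecture.HodgeConjecture.Theorems.F0P3cStCharTSRepHyperbolic        -- ★ p850107 (F0P3-p01 (g20)) «REP-HYPERBOLIC» (its conclusion is the `hrepH` binder) + `valued_apply_mul_valued_apply_eq_one_of_glDiagonal_eq`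
import Summits.HodgeConjecture.HodgeConjecture.Theorems.F0P3cStCharTSFH0Kit               -- ★ p850205 (F0P2-p02 (g15)) «FH0-KIT» `isLevel_gH`, `isLocSmooth_gH`, `isOpen_coe_KH`, `isCompact_coe_KH`
import Summits.HodgeConjecture.HodgeConjecture.Theorems.F0P3cStCharTSShellOrbitalGSupport  -- ★ (LH2-p03 (g3)) `isUnit_sub_of_valued_apply_ne` (distinct `w`-valuations ⇒ unit difference)
import Summits.HodgeConjecture.HodgeConjecture.Theorems.F0P3XiLocalCharOpenKernel          -- ★ `isOpen_ker_of_continuous_of_isCompact_isOpen_subgroup`; brings ★ `isCompact_isOpen_cmLocalIntegralLevel`, ★ `totallyDisconnectedSpace_cmDatum_local`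
import Literature.NumberTheory.Rogawski1990.SemilocalQuadraticCharExtension                -- ★ `isQuadraticCharExtension_semilocalComponent_of_baseChange_eq` (`μ_v ∘ σ = μ_v⁻¹` from `μ|_𝔸⁺ = ω`)
import Literature.NumberTheory.Automorphic.CMBorelWeylTorusConjugateTwo                    -- ★ `glDiagonal_rev_eq_weylConj_two`, `weylConj_mem_cmTorus_two` (`ʷt = diag(d ∘ rev)`)
import HarnessLib

/-!
# F0 · P3c · line LH6 «StCharTS» — road (D) «DEEP-FL», (D-c)(δ₄) «VALUE AT THE FLIPS»: the head's `case value` as ONE theorem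
# `Tr St_H(ξ_v)(Σ_{u∈F} c_u • 𝟙_{K_H u K_H}) = A_G · χ_ξ(b)` over ★ VALUE-OF-CHECKLIST, instantiated at the H-dominant flips `ʷu = (w₂ u₁ w₂⁻¹, u₂)`
# [Rogawski1990, §12.7 L. 12.7.3 (proof) p. 195; §12.1 case (1) pp. 171–172; §4.9 Lemma 4.9.2, (4.9.4) p. 56] [Casselman1995, L. 7.1.1 (a)]

Cell `pub/hodgecm-mathlib`, crux H413 = `stmt-HodgeConjecture-24833` (lane `--supports … --as helper`), route HCCMUnconditional; seat LH6-p02 (g3) (heir of the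
VALUE lineage: ★ p849817 (δ₄)-core, ★ p850018 VALUE third, ★ p850245 KAPPA-RATIO; constants sheet `F0/P3b/LH6-p02/g2/KAPPA-RATIO.sheet.v1.md` c7274337 = the VALUE
letters of record, road (D) owner LH6-p04 (g3) ruling 2026-09-02T07:32:36Z).  Consumer: the (D-c) HEAD «XIG-ASSEMBLY» (A-p16 (g34) skeleton v5 361780d7,
`case value`).  THEOREMS ONLY, sorry-free, ★-only imports; no definition ∕ instance ∕ notation ∕ named fact.  HONEST LABEL: HC_CM is proved only modulo the 7
printed citations (2 remaining: hLiu418 = stmt-HodgeConjecture-24832, h413 = stmt-HodgeConjecture-24833) until rung 0 closes; count-neutral — this closes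
nothing by itself, it turns the head's VALUE conjunct into one `exact`.

THE MATHEMATICS (sheet §0 «ORIENTATION RULE»).  The representatives `u = (u₁, u₂) ∈ F ⊆ T₂ × U(Φ₁)_v` of the shell cover (★ XIG-DATA) are hlevi-ORIENTED
(`|d′₁|_w < |d′₀|_w`, ★ REP-HYPERBOLIC), i.e. ANTI-dominant for `B₂`; the Steinberg exponent of `i_H(χ_H)` sits at the DOMINANT flip `ʷu₁ = w₂ u₁ w₂⁻¹`, so ★ p850018
`steinbergLabel_smoothTrace_sum_eq_cmXiTorusChar` must be read at `h u := ʷu₁`, `z u := u₂`, `b′ := b` (the XIG point `z·aᵐ` itself):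
  (TRj)  `Tr St_H(ξ_v)(𝟙_{K_H u K_H}) = A_u · (χ_{H,2}(ʷu₁) · ψ_v(det u₂))` — the `htr♭` binder (★ HTR-AT-REPS, F0P2-p06 (g15), delivers it in the ORIENTED grouping
         `(A_u·χ_{H,2}(ʷu₁)·χ_{H,2}(u₁)⁻¹)·(χ_{H,2}(u₁)·ψ_v(det u₂))`; §1 `htr_flip_of_oriented` regroups — a unit cancels);
  (DIAG) `ʷu₁ = diag(d′ ∘ rev)` (★ `glDiagonal_rev_eq_weylConj_two`) and `(d′₁)⁻¹·γ₂ − 1` is a unit: `|γ₂|_w = 1`, `|d′₁|_w < |d′₀|_w`, `|d′₀|_w·|d′₁|_w = 1` ⇒ `|d′₁|_w ≠ 1`,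
         distinct `w`-valuations ⇒ unit (★ `isUnit_sub_of_valued_apply_ne`) — §3 `exists_glDiagonal_flip_and_isUnit`, from ★ REP-HYPERBOLIC's conclusion BY SHAPE;
  (TAU)  `τ_v(ʷu₁, u₂) = τ_v(u₁, u₂)` (★ `finTau_weylFlip`, `τ_v` is a class function);
  (VAL)  `c_u·(A_u·r_H) = τ_u·(A_G·r_G)` from the head's `hval : c_u·κ_{H,u} = τ_u·(κ_G κ)` and the closed forms `κ_{H,u} = A_u·r_H`, `κ_G κ = A_G·r_G` (★ KAPPA-RATIO `hAH`∕`hAG`);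
  (CNT)  `|F|·r_G = r_H`, `r_H ≠ 0` (★ HCARD, LH5-p01 (g2));  (R5) `χ_ξ|_{S_n} = 1`;  `hrep♭ : ι_v(ʷu) ∈ b·S_n` (★ FLIP-REP, LH6-p03 (g2), BY SHAPE);
  `hψo` (the kernel of `ψ_v∘det` is open — §2, no hypothesis) and `hμ` (`μ_v∘σ = μ_v⁻¹` from `μ|_{𝔸_{L⁺}} = ω_{L∕L⁺}`, ★ `isQuadraticCharExtension_semilocalComponent_of_baseChange_eq`)
⟹ **`Tr St_H(ξ_v)(Σ_{u∈F} c_u • 𝟙_{K_H u K_H}) = A_G · χ_ξ(b)`** (§4 `smoothTrace_fH0_eq_mul_cmXiTorusChar`).  At `b := ⟨z·𝓘.aᵐ, hbM⟩`,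
`A_G := νQv(K_n)·#R·δ_B^{1∕2}(b)` this is conjunct 3 of XIG′ (v3 8370ced9a3c5de43) token for token.

* §1 `htr_flip_of_oriented` — the (I)→(II) regrouping of the per-summand traces (generic units algebra).
* §2 `isOpen_ker_psi_comp_localDet` — `hψo` discharged: `ker(ψ_v ∘ det) ≤ U(Φ₁)(L⁺_v)` is open (continuous `ℂˣ`-character of a t.d. group with a compact open subgroup).
* §3 `exists_glDiagonal_flip_and_isUnit` — (DIAG) at every `u ∈ F` from ★ REP-HYPERBOLIC's conclusion.
* §4 **`smoothTrace_fH0_eq_mul_cmXiTorusChar`** — VALUE AT THE FLIPS; **`smoothTrace_fH0_eq_mul_cmXiTorusChar_of_oriented`** — the same fed with the ORIENTED `htr`.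

## References
* [Rogawski1990] J. D. Rogawski, *Automorphic Representations of Unitary Groups in Three Variables*, Ann. of Math. Stud. 123 (1990): §1.10 p. 9; §4.9 Lemma 4.9.2,
  (4.9.4) pp. 55–56; §12.1 case (1) pp. 171–172; §12.7 Lemma 12.7.3 (proof) p. 195.
* [Casselman1995] W. Casselman, *Introduction to the theory of admissible representations of p-adic reductive groups* (1995), Lemma 7.1.1 (a).
* [BushnellHenniart2006] C. J. Bushnell, G. Henniart, *The Local Langlands Conjecture for GL(2)*, Grundlehren 335 (2006), §1.5 (characters of t.d. groups).
-/

set_option autoImplicit false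
-- the mandated namespace has the single-problem summit's repeated segment (`HodgeConjecture.HodgeConjecture`)
set_option linter.dupNamespace false

noncomputable section

open NumberField IsDedekindDomain MeasureTheory Topology
open scoped Matrix MatrixGroups Pointwise
open Literature.NumberTheory Literature.NumberTheory.Automorphic Literature.NumberTheory.Automorphic.UnitaryGroup
open Literature.NumberTheory.GaloisRepresentations
open Literature.NumberTheory.Rogawski1990

namespace Summit.HodgeConjecture.HodgeConjecture.Cruxes.H413.F0P3cStCharTSValueAtFlips

/-! ## §1 Generic: regrouping the ORIENTED per-summand trace -/

/-- **(I)→(II) regrouping**: `(A·x·c⁻¹)·(c·p) = A·(x·p)` for a unit `c` — the ORIENTED `htr` of ★ HTR-AT-REPS (`c = χ_{H,2}(u₁)`, `x = χ_{H,2}(ʷu₁)`, `p = ψ_v(det u₂)`)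
regrouped to the flipped lettering of the sheet. [cite: Rogawski1990, §12.7 Lemma 12.7.3 (proof) p. 195] -/
theorem htr_flip_of_oriented {ι : Type*} (F : Finset ι) (T A : ι → ℂ) (x c : ι → ℂˣ) (p : ι → ℂ)
    (htr : ∀ u ∈ F, T u = A u * ((x u : ℂˣ) : ℂ) * ((c u : ℂˣ) : ℂ)⁻¹ * (((c u : ℂˣ) : ℂ) * p u)) :
    ∀ u ∈ F, T u = A u * (((x u : ℂˣ) : ℂ) * p u) := by
  intro u hu
  rw [htr u hu]
  have hc : ((c u : ℂˣ) : ℂ) ≠ 0 := Units.ne_zero _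
  field_simp

/-! ## §2 `hψo`: the kernel of `ψ_v ∘ det` on `U(Φ₁)(L⁺_v)` is open -/

section CM

variable (L : Type) [Field L] [NumberField L] [IsCMField L] (v : HeightOneSpectrum (𝓞 ↥(maximalRealSubfield L)))

/-- **`ker (ψ_v ∘ det) ≤ U(Φ₁)(L⁺_v)` is open**: `ψ_v ∘ det` is a continuous `ℂˣ`-character (★ `continuous_torusLocalComponent`, ★ `continuous_localDet`) of the totally
disconnected group `U(Φ₁)(L⁺_v)` with the compact open subgroup `K_{1,v}` (★ `isCompact_isOpen_cmLocalIntegralLevel`), so ★ `isOpen_ker_of_continuous_of_isCompact_isOpen_subgroup`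
applies — the `hψo` binder of ★ p850018 ∕ ★ HTR-AT-REPS, discharged. [cite: BushnellHenniart2006, §1.5] [cite: Rogawski1990, §12.1 p. 171] -/
theorem isOpen_ker_psi_comp_localDet (ψ : ↥(Arthur2013.Leaves.TECR.TorusDict.torus (IsCMField.complexConj L)) →ₜ* ℂˣ) :
    IsOpen (SetLike.coe (MonoidHom.ker ((torusLocalComponent L (IsCMField.complexConj L) v ψ).comp
      (localDet (IsCMField.complexConj L) v (isUnit_antidiagOne_det L 1))))) := by
  haveI := totallyDisconnectedSpace_cmDatum_local L 1 (Matrix.of fun i j : Fin 1 => if i.val + j.val + 1 = 1 then (1 : L) else 0) v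
  have h1 := isCompact_isOpen_cmLocalIntegralLevel L 1 (Matrix.of fun i j : Fin 1 => if i.val + j.val + 1 = 1 then (1 : L) else 0) v
  exact F0P3XiLocalCharOpenKernel.isOpen_ker_of_continuous_of_isCompact_isOpen_subgroup
    (cmLocalIntegralLevel L 1 (Matrix.of fun i j : Fin 1 => if i.val + j.val + 1 = 1 then (1 : L) else 0) v) h1.1 h1.2 _
    (Units.isEmbedding_val₀.continuous_iff.2
      ((continuous_torusLocalComponent (v := v) L (IsCMField.complexConj L) ψ).comp (continuous_localDet (IsCMField.complexConj L) v (isUnit_antidiagOne_det L 1))))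

/-! ## §3 (DIAG): the flipped representative is diagonal with reversed entries, and `G`-regular in the unit form -/

variable (w : PlacesOver L v) (hw : IsCMField.complexConj L • w.1 = w.1)

include hw in
set_option maxHeartbeats 1600000 in  -- statement-level `whnf` on the CM carriers
/-- **(DIAG) at one representative.**  For `u = (u₁, u₂) ∈ T₂ × U(Φ₁)_v` with `u₁ = diag(d′)`, `|d′₁|_w < |d′₀|_w` and `|γ₂(u)|_w = 1` (★ REP-HYPERBOLIC's first and third
conjuncts): `ʷu₁ := w₂ u₁ w₂⁻¹ = diag(d′ ∘ rev)` (★ `glDiagonal_rev_eq_weylConj_two`) and `(d′ ∘ rev)₀⁻¹ · γ₂(ʷu) − 1 = (d′₁)⁻¹γ₂ − 1` is a unit of `∏_{w∣v} L_w`: its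
`w`-valuation is `|d′₁|_w⁻¹ ≠ 1 = |1|_w` since `|d′₀|_w·|d′₁|_w = 1` (★ `valued_apply_mul_valued_apply_eq_one_of_glDiagonal_eq`) forbids `|d′₁|_w = 1` (★ `isUnit_sub_of_valued_apply_ne`).
This is the pair `hd′ ∕ ha` of ★ p850018 at the flipped rep. [cite: Rogawski1990, §1.10 p. 9; §4.9 Lemma 4.9.2 p. 56] -/
theorem exists_glDiagonal_flip_and_isUnit
    (w₂ : ↥(unitaryGroupOfForm (conjLocal L (IsCMField.complexConj L) v) (cmLocalForm L 2 v)))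
    (hw₂ : Units.val (w₂ : GL (Fin 2) (LocalRing L v)) = cmLocalForm L 2 v)
    (u : ↥(cmBorelTriple L 2 v).M × (cmDatum L 1 (Matrix.of fun i j : Fin 1 => if i.val + j.val + 1 = 1 then (1 : L) else 0)).Local v)
    {d' : Fin 2 → (LocalRing L v)ˣ}
    (hd' : glDiagonal 2 (LocalRing L v) d' = ((u.1 : ↥(unitaryGroupOfForm (conjLocal L (IsCMField.complexConj L) v) (cmLocalForm L 2 v))) : GL (Fin 2) (LocalRing L v)))
    (hlt : Valued.v (((d' 1 : (LocalRing L v)ˣ) : LocalRing L v) w) < Valued.v (((d' 0 : (LocalRing L v)ˣ) : LocalRing L v) w))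
    (hγ : Valued.v (finGammaTwo L v ((u.1 : ↥(unitaryGroupOfForm (conjLocal L (IsCMField.complexConj L) v) (cmLocalForm L 2 v))), u.2) w) = 1) :
    glDiagonal 2 (LocalRing L v) (fun i : Fin 2 => d' i.rev) =
        ((((⟨w₂ * (u.1 : ↥(unitaryGroupOfForm (conjLocal L (IsCMField.complexConj L) v) (cmLocalForm L 2 v))) * w₂⁻¹, weylConj_mem_cmTorus_two L v w₂ hw₂ u.1⟩ :
              ↥(cmBorelTriple L 2 v).M) : ↥(unitaryGroupOfForm (conjLocal L (IsCMField.complexConj L) v) (cmLocalForm L 2 v))), u.2) :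
            ((cmDatum L 2 (Matrix.of fun i j : Fin 2 => if i.val + j.val + 1 = 2 then (1 : L) else 0)).Local v) ×
              ((cmDatum L 1 (Matrix.of fun i j : Fin 1 => if i.val + j.val + 1 = 1 then (1 : L) else 0)).Local v)).1.val ∧
      IsUnit (((((fun i : Fin 2 => d' i.rev) 0)⁻¹ * (isUnit_finGammaTwo L v
          ((((⟨w₂ * (u.1 : ↥(unitaryGroupOfForm (conjLocal L (IsCMField.complexConj L) v) (cmLocalForm L 2 v))) * w₂⁻¹, weylConj_mem_cmTorus_two L v w₂ hw₂ u.1⟩ :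
              ↥(cmBorelTriple L 2 v).M) : ↥(unitaryGroupOfForm (conjLocal L (IsCMField.complexConj L) v) (cmLocalForm L 2 v))), u.2) :
            ((cmDatum L 2 (Matrix.of fun i j : Fin 2 => if i.val + j.val + 1 = 2 then (1 : L) else 0)).Local v) ×
              ((cmDatum L 1 (Matrix.of fun i j : Fin 1 => if i.val + j.val + 1 = 1 then (1 : L) else 0)).Local v))).unit : (LocalRing L v)ˣ) :
          LocalRing L v) - 1) := by
  refine ⟨glDiagonal_rev_eq_weylConj_two (conjLocal L (IsCMField.complexConj L) v) (cmLocalForm_eq_over L 2 v) w₂ hw₂ u.1 hd', ?_⟩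
  have hprod := F0P3cStCharTSRepHyperbolic.valued_apply_mul_valued_apply_eq_one_of_glDiagonal_eq L v w hw u.1 hd'
  -- `|d′₁|_w ≠ 1`
  have hne1 : Valued.v (((d' 1 : (LocalRing L v)ˣ) : LocalRing L v) w) ≠ 1 := by
    intro h1
    rw [h1, mul_one] at hprod
    rw [h1, hprod] at hlt
    exact lt_irrefl _ hlt
  -- the generic step: for ANY unit `γu` with underlying element `γ₂(u)`, `(d′₁)⁻¹ γu − 1` is a unit (`|d′₁|_w · |((d′₁)⁻¹ γu)_w|_w = |γ₂|_w = 1`)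
  have key : ∀ γu : (LocalRing L v)ˣ, ((γu : (LocalRing L v)ˣ) : LocalRing L v) =
      finGammaTwo L v ((u.1 : ↥(unitaryGroupOfForm (conjLocal L (IsCMField.complexConj L) v) (cmLocalForm L 2 v))), u.2) →
      IsUnit ((((d' 1)⁻¹ * γu : (LocalRing L v)ˣ) : LocalRing L v) - 1) := by
    intro γu hγval
    refine F0P3cStCharTSShellOrbitalG.isUnit_sub_of_valued_apply_ne L w hw ?_
    rw [Pi.one_apply, map_one]
    intro heq
    have e : (d' 1 : (LocalRing L v)ˣ) * ((d' 1)⁻¹ * γu) = γu := mul_inv_cancel_left _ _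
    have h := congrArg (fun y : (LocalRing L v)ˣ => Valued.v (((y : (LocalRing L v)ˣ) : LocalRing L v) w)) e
    simp only [Units.val_mul, Pi.mul_apply, map_mul] at h heq
    rw [heq, mul_one, hγval, hγ] at h
    exact hne1 h
  exact key _ (by rw [IsUnit.unit_spec]; rfl)

/-! ## §4 VALUE AT THE FLIPS -/

include hw in
set_option maxHeartbeats 1600000 in  -- statement-level `whnf` on the CM carriers (as ★ p850018 ∕ ★ ST-SHELL-TRACE)
/-- **(δ₄) «VALUE AT THE FLIPS» — the VALUE conjunct of XIG′ for the refined test function `f^H₀ = Σ_{u∈F} c_u • 𝟙_{K_H u K_H}`, `K_H = K_{2,n′} × K₁`.**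
★ p850018 `steinbergLabel_smoothTrace_sum_eq_cmXiTorusChar` read at the H-dominant flips `h u := ʷu₁ = w₂ u₁ w₂⁻¹`, `z u := u₂`, `b′ := b` (sheet §0): its `hd′ ∕ ha` come
from §3 over ★ REP-HYPERBOLIC's conclusion (`hrepH`, BY SHAPE), `hτ` from ★ `finTau_weylFlip`, `hc` from the head's `hval` and the closed forms `hAH ∕ hAG` (★ KAPPA-RATIO),
`hK ∕ hg` from ★ FH0-KIT, `hψo` from §2, `hμ` from `μ|_{𝔸_{L⁺}} = ω`; `htr♭`, `hrep♭` (★ HTR-AT-REPS, ★ FLIP-REP), `hcard ∕ hrH` (★ HCARD) and (R5) `hSn` enter BY SHAPE.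
Conclusion **`Tr St_H(ξ_v)(f^H₀) = A_G · χ_ξ(b)`** — at `b := ⟨z·𝓘.aᵐ, hbM⟩`, `A_G := νQv(K_n)·#R·δ_B^{1∕2}(b)` conjunct 3 of XIG′ verbatim.
[cite: Rogawski1990, §12.7 Lemma 12.7.3 (proof) p. 195; §12.1 case (1) pp. 171–172; §4.9 Lemma 4.9.2 p. 56] [cite: Casselman1995, L. 7.1.1 (a)] -/
theorem smoothTrace_fH0_eq_mul_cmXiTorusChar
    [MeasurableSpace (((cmDatum L 2 (Matrix.of fun i j : Fin 2 => if i.val + j.val + 1 = 2 then (1 : L) else 0)).Local v) ×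
      ((cmDatum L 1 (Matrix.of fun i j : Fin 1 => if i.val + j.val + 1 = 1 then (1 : L) else 0)).Local v))]
    [BorelSpace (((cmDatum L 2 (Matrix.of fun i j : Fin 2 => if i.val + j.val + 1 = 2 then (1 : L) else 0)).Local v) ×
      ((cmDatum L 1 (Matrix.of fun i j : Fin 1 => if i.val + j.val + 1 = 1 then (1 : L) else 0)).Local v))]
    (νH : Measure (((cmDatum L 2 (Matrix.of fun i j : Fin 2 => if i.val + j.val + 1 = 2 then (1 : L) else 0)).Local v) ×
      ((cmDatum L 1 (Matrix.of fun i j : Fin 1 => if i.val + j.val + 1 = 1 then (1 : L) else 0)).Local v)))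
    [νH.IsHaarMeasure] [νH.IsMulRightInvariant]
    (hns : ∀ w : PlacesOver L v, IsCMField.complexConj L • w.1 = w.1) (ξ : OneDimAutRepH L)
    (π₁ πSt : IrrClass (((cmDatum L 2 (Matrix.of fun i j : Fin 2 => if i.val + j.val + 1 = 2 then (1 : L) else 0)).Local v) ×
      ((cmDatum L 1 (Matrix.of fun i j : Fin 1 => if i.val + j.val + 1 = 1 then (1 : L) else 0)).Local v)))
    (hlab : HLengthTwoLabels L v
      (torusCharPair (conjLocal L (IsCMField.complexConj L) v) (cmLocalForm L 2 v) (cmLocalForm_eq_over L 2 v) 0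
        ((torusLocalComponent L (IsCMField.complexConj L) v ξ.η).comp
            (quotConj (conjLocal L (IsCMField.complexConj L) v) (conjLocal_conjLocal_cm L v)) *
          halfModulusChar (UnitaryGroup.LocalRing L v))
        (torusLocalComponent L (IsCMField.complexConj L) v ξ.ψ))
      ((torusLocalComponent L (IsCMField.complexConj L) v ξ.ψ).comp (localDet (IsCMField.complexConj L) v (isUnit_antidiagOne_det L 1))) π₁ πSt)
    (hπ₁ : ∀ fH : ((cmDatum L 2 (Matrix.of fun i j : Fin 2 => if i.val + j.val + 1 = 2 then (1 : L) else 0)).Local v) ×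
        ((cmDatum L 1 (Matrix.of fun i j : Fin 1 => if i.val + j.val + 1 = 1 then (1 : L) else 0)).Local v) → ℂ,
      IsLocSmooth fH → π₁.smoothTrace νH fH = charDist (ξ.xiLocalChar v) νH fH)
    -- the endoscopic character
    (μ : HeckeCharacter L)
    (hμω : ∀ x : Literature.NumberTheory.GaloisRepresentations.ideleGroup ↥(maximalRealSubfield L),
      μ (AdeleRing.ideleBaseChange (↥(maximalRealSubfield L)) L x) = quadraticHeckeCharCM L x)
    -- the H-shell level `K_H := K_{2,n′} × K₁` and the H-Weyl element `w₂`
    (𝓘₂ : (cmBorelTriple L 2 v).IwahoriDatum) (n' : ℕ)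
    (K₁ : Subgroup ((cmDatum L 1 (Matrix.of fun i j : Fin 1 => if i.val + j.val + 1 = 1 then (1 : L) else 0)).Local v))
    (hK₁o : IsOpen (K₁ : Set ((cmDatum L 1 (Matrix.of fun i j : Fin 1 => if i.val + j.val + 1 = 1 then (1 : L) else 0)).Local v)))
    (hK₁c : IsCompact (K₁ : Set ((cmDatum L 1 (Matrix.of fun i j : Fin 1 => if i.val + j.val + 1 = 1 then (1 : L) else 0)).Local v)))
    (w₂ : ↥(unitaryGroupOfForm (conjLocal L (IsCMField.complexConj L) v) (cmLocalForm L 2 v)))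
    (hw₂ : Units.val (w₂ : GL (Fin 2) (LocalRing L v)) = cmLocalForm L 2 v)
    -- the cover `F ⊆ T₂ × U(Φ₁)_v` and ★ REP-HYPERBOLIC's conclusion BY SHAPE
    (F : Finset (↥(cmBorelTriple L 2 v).M × ((cmDatum L 1 (Matrix.of fun i j : Fin 1 => if i.val + j.val + 1 = 1 then (1 : L) else 0)).Local v)))
    (hrepH : ∀ u ∈ F,
      (∃ d' : Fin 2 → (LocalRing L v)ˣ,
        glDiagonal 2 (LocalRing L v) d' = ((u.1 : ↥(unitaryGroupOfForm (conjLocal L (IsCMField.complexConj L) v) (cmLocalForm L 2 v))) : GL (Fin 2) (LocalRing L v)) ∧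
        Valued.v (((d' 1 : (LocalRing L v)ˣ) : LocalRing L v) w) < Valued.v (((d' 0 : (LocalRing L v)ˣ) : LocalRing L v) w) ∧
        galAdicCompletionMap (L := L) (IsCMField.complexConj L) hw (((d' 0 : (LocalRing L v)ˣ) : LocalRing L v) w) * ((d' 1 : (LocalRing L v)ˣ) : LocalRing L v) w = 1) ∧
      (∃ d₀ d₁ : w.1.adicCompletion L,
        (((localNonsplitEquiv (IsCMField.complexConj L) (Matrix.of fun i j : Fin 2 => if i.val + j.val + 1 = 2 then (1 : L) else 0) (IsCMField.complexConj_ne_one L) w hw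
              (u.1 : ↥(unitaryGroupOfForm (conjLocal L (IsCMField.complexConj L) v) (cmLocalForm L 2 v))) :
            ↥(unitaryGroupOfForm (galAdicCompletionMap (L := L) (IsCMField.complexConj L) hw) (placeForm (Matrix.of fun i j : Fin 2 => if i.val + j.val + 1 = 2 then (1 : L) else 0) w.1))) :
            GL (Fin 2) (w.1.adicCompletion L)) : Matrix (Fin 2) (Fin 2) (w.1.adicCompletion L)) = Matrix.diagonal ![d₀, d₁] ∧
        Valued.v d₁ < Valued.v d₀ ∧ Valued.v d₀ * Valued.v d₁ = 1 ∧ galAdicCompletionMap (L := L) (IsCMField.complexConj L) hw d₀ * d₁ = 1) ∧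
      Valued.v (finGammaTwo L v ((u.1 : ↥(unitaryGroupOfForm (conjLocal L (IsCMField.complexConj L) v) (cmLocalForm L 2 v))), u.2) w) = 1)
    -- (R5): `χ_ξ` is trivial on the shell group `S_n ≤ T₃`; the XIG point `b ∈ T₃`; ★ FLIP-REP's conclusion BY SHAPE
    (Sn : Subgroup ↥(cmBorelTriple L 3 v).M)
    (hSn : ∀ t ∈ Sn, cmXiTorusChar L v (μ.semilocalComponent L v) (torusLocalComponent L (IsCMField.complexConj L) v ξ.η)
      (torusLocalComponent L (IsCMField.complexConj L) v ξ.ψ) t = 1)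
    (b : ↥(cmBorelTriple L 3 v).M)
    (hrep : ∀ u ∈ F, ∃ t ∈ b • (Sn : Set ↥(cmBorelTriple L 3 v).M),
      (t : ↥(unitaryGroupOfForm (conjLocal L (IsCMField.complexConj L) v) (cmLocalForm L 3 v))) =
        endoEmbLocal L v
          (((⟨w₂ * (u.1 : ↥(unitaryGroupOfForm (conjLocal L (IsCMField.complexConj L) v) (cmLocalForm L 2 v))) * w₂⁻¹, weylConj_mem_cmTorus_two L v w₂ hw₂ u.1⟩ :
              ↥(cmBorelTriple L 2 v).M) : ↥(unitaryGroupOfForm (conjLocal L (IsCMField.complexConj L) v) (cmLocalForm L 2 v))), u.2))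
    -- the coefficients and the closed-form constants (abstract letters; the head's `hval`, ★ KAPPA-RATIO `hAH ∕ hAG`, ★ HCARD `hcard ∕ hrH`)
    (cj κH A : ↥(cmBorelTriple L 2 v).M × ((cmDatum L 1 (Matrix.of fun i j : Fin 1 => if i.val + j.val + 1 = 1 then (1 : L) else 0)).Local v) → ℂ)
    (κG κ AG rG rH : ℂ)
    (hval : ∀ u ∈ F, cj u * κH u =
      finTau L v (((u.1 : ↥(unitaryGroupOfForm (conjLocal L (IsCMField.complexConj L) v) (cmLocalForm L 2 v))), u.2) :
        ((cmDatum L 2 (Matrix.of fun i j : Fin 2 => if i.val + j.val + 1 = 2 then (1 : L) else 0)).Local v) ×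
          ((cmDatum L 1 (Matrix.of fun i j : Fin 1 => if i.val + j.val + 1 = 1 then (1 : L) else 0)).Local v)) μ * (κG * κ))
    (hAH : ∀ u ∈ F, κH u = A u * rH) (hAG : κG * κ = AG * rG) (hrH : rH ≠ 0) (hcard : (F.card : ℂ) * rG = rH)
    -- the per-summand traces at the flips (★ HTR-AT-REPS, regrouped by §1)
    (htr : ∀ u ∈ F, πSt.smoothTrace νH ((DoubleCoset.doubleCoset
        (((u.1 : ↥(unitaryGroupOfForm (conjLocal L (IsCMField.complexConj L) v) (cmLocalForm L 2 v))), u.2) :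
          ↥(unitaryGroupOfForm (conjLocal L (IsCMField.complexConj L) v) (cmLocalForm L 2 v)) ×
            (cmDatum L 1 (Matrix.of fun i j : Fin 1 => if i.val + j.val + 1 = 1 then (1 : L) else 0)).Local v)
        (((𝓘₂.K n').prod K₁ : Subgroup (↥(unitaryGroupOfForm (conjLocal L (IsCMField.complexConj L) v) (cmLocalForm L 2 v)) ×
            (cmDatum L 1 (Matrix.of fun i j : Fin 1 => if i.val + j.val + 1 = 1 then (1 : L) else 0)).Local v)) : Set _)
        ((𝓘₂.K n').prod K₁ : Subgroup (↥(unitaryGroupOfForm (conjLocal L (IsCMField.complexConj L) v) (cmLocalForm L 2 v)) ×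
            (cmDatum L 1 (Matrix.of fun i j : Fin 1 => if i.val + j.val + 1 = 1 then (1 : L) else 0)).Local v))).indicator fun _ => (1 : ℂ)) =
      A u * ((((torusCharPair (conjLocal L (IsCMField.complexConj L) v) (cmLocalForm L 2 v) (cmLocalForm_eq_over L 2 v) 0
        ((torusLocalComponent L (IsCMField.complexConj L) v ξ.η).comp
            (quotConj (conjLocal L (IsCMField.complexConj L) v) (conjLocal_conjLocal_cm L v)) *
          halfModulusChar (UnitaryGroup.LocalRing L v))
        (torusLocalComponent L (IsCMField.complexConj L) v ξ.ψ))
          ⟨w₂ * (u.1 : ↥(unitaryGroupOfForm (conjLocal L (IsCMField.complexConj L) v) (cmLocalForm L 2 v))) * w₂⁻¹, weylConj_mem_cmTorus_two L v w₂ hw₂ u.1⟩ : ℂˣ) : ℂ) *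
        ((((torusLocalComponent L (IsCMField.complexConj L) v ξ.ψ).comp (localDet (IsCMField.complexConj L) v (isUnit_antidiagOne_det L 1))) u.2 : ℂˣ) : ℂ))) :
    πSt.smoothTrace νH (∑ u ∈ F, cj u • (DoubleCoset.doubleCoset
        (((u.1 : ↥(unitaryGroupOfForm (conjLocal L (IsCMField.complexConj L) v) (cmLocalForm L 2 v))), u.2) :
          ↥(unitaryGroupOfForm (conjLocal L (IsCMField.complexConj L) v) (cmLocalForm L 2 v)) ×
            (cmDatum L 1 (Matrix.of fun i j : Fin 1 => if i.val + j.val + 1 = 1 then (1 : L) else 0)).Local v)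
        (((𝓘₂.K n').prod K₁ : Subgroup (↥(unitaryGroupOfForm (conjLocal L (IsCMField.complexConj L) v) (cmLocalForm L 2 v)) ×
            (cmDatum L 1 (Matrix.of fun i j : Fin 1 => if i.val + j.val + 1 = 1 then (1 : L) else 0)).Local v)) : Set _)
        ((𝓘₂.K n').prod K₁ : Subgroup (↥(unitaryGroupOfForm (conjLocal L (IsCMField.complexConj L) v) (cmLocalForm L 2 v)) ×
            (cmDatum L 1 (Matrix.of fun i j : Fin 1 => if i.val + j.val + 1 = 1 then (1 : L) else 0)).Local v))).indicator fun _ => (1 : ℂ)) =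
      AG * ((cmXiTorusChar L v (μ.semilocalComponent L v) (torusLocalComponent L (IsCMField.complexConj L) v ξ.η)
        (torusLocalComponent L (IsCMField.complexConj L) v ξ.ψ) b : ℂˣ) : ℂ) := by
  have hμ := isQuadraticCharExtension_semilocalComponent_of_baseChange_eq μ hμω v
  have hψo := isOpen_ker_psi_comp_localDet L v ξ.ψ
  -- (DIAG) at every `u ∈ F`
  have hdiag : ∀ u ∈ F, ∃ d'' : Fin 2 → (LocalRing L v)ˣ,
      glDiagonal 2 (LocalRing L v) d'' =
          ((((⟨w₂ * (u.1 : ↥(unitaryGroupOfForm (conjLocal L (IsCMField.complexConj L) v) (cmLocalForm L 2 v))) * w₂⁻¹, weylConj_mem_cmTorus_two L v w₂ hw₂ u.1⟩ :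
                ↥(cmBorelTriple L 2 v).M) : ↥(unitaryGroupOfForm (conjLocal L (IsCMField.complexConj L) v) (cmLocalForm L 2 v))), u.2) :
              ((cmDatum L 2 (Matrix.of fun i j : Fin 2 => if i.val + j.val + 1 = 2 then (1 : L) else 0)).Local v) ×
                ((cmDatum L 1 (Matrix.of fun i j : Fin 1 => if i.val + j.val + 1 = 1 then (1 : L) else 0)).Local v)).1.val ∧
        IsUnit ((((d'' 0)⁻¹ * (isUnit_finGammaTwo L v
            ((((⟨w₂ * (u.1 : ↥(unitaryGroupOfForm (conjLocal L (IsCMField.complexConj L) v) (cmLocalForm L 2 v))) * w₂⁻¹, weylConj_mem_cmTorus_two L v w₂ hw₂ u.1⟩ :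
                ↥(cmBorelTriple L 2 v).M) : ↥(unitaryGroupOfForm (conjLocal L (IsCMField.complexConj L) v) (cmLocalForm L 2 v))), u.2) :
              ((cmDatum L 2 (Matrix.of fun i j : Fin 2 => if i.val + j.val + 1 = 2 then (1 : L) else 0)).Local v) ×
                ((cmDatum L 1 (Matrix.of fun i j : Fin 1 => if i.val + j.val + 1 = 1 then (1 : L) else 0)).Local v))).unit : (LocalRing L v)ˣ) :
            LocalRing L v) - 1) := by
    intro u hu
    obtain ⟨⟨d', hd', hlt, -⟩, -, hγ⟩ := hrepH u hu
    exact ⟨fun i : Fin 2 => d' i.rev, exists_glDiagonal_flip_and_isUnit L v w hw w₂ hw₂ u hd' hlt hγ⟩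
  choose! d'' hd'' ha'' using hdiag
  haveI := locallyCompactSpace_cmBorelU L 2 v
  refine F0P3cStCharTSValueChecklist.steinbergLabel_smoothTrace_sum_eq_cmXiTorusChar L v νH ξ hns π₁ πSt hlab hπ₁ hψo ((𝓘₂.K n').prod K₁)
    (F0P3cStCharTSFH0Kit.isOpen_coe_KH L v 𝓘₂ n' K₁ hK₁o) (F0P3cStCharTSFH0Kit.isCompact_coe_KH L v 𝓘₂ n' K₁ hK₁c) F cj
    (fun u => (DoubleCoset.doubleCoset
        (((u.1 : ↥(unitaryGroupOfForm (conjLocal L (IsCMField.complexConj L) v) (cmLocalForm L 2 v))), u.2) :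
          ↥(unitaryGroupOfForm (conjLocal L (IsCMField.complexConj L) v) (cmLocalForm L 2 v)) ×
            (cmDatum L 1 (Matrix.of fun i j : Fin 1 => if i.val + j.val + 1 = 1 then (1 : L) else 0)).Local v)
        (((𝓘₂.K n').prod K₁ : Subgroup (↥(unitaryGroupOfForm (conjLocal L (IsCMField.complexConj L) v) (cmLocalForm L 2 v)) ×
            (cmDatum L 1 (Matrix.of fun i j : Fin 1 => if i.val + j.val + 1 = 1 then (1 : L) else 0)).Local v)) : Set _)
        ((𝓘₂.K n').prod K₁ : Subgroup (↥(unitaryGroupOfForm (conjLocal L (IsCMField.complexConj L) v) (cmLocalForm L 2 v)) ×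
            (cmDatum L 1 (Matrix.of fun i j : Fin 1 => if i.val + j.val + 1 = 1 then (1 : L) else 0)).Local v))).indicator fun _ => (1 : ℂ))
    (fun u _ => F0P3cStCharTSFH0Kit.isLocSmooth_gH L v 𝓘₂ n' K₁ hK₁o hK₁c u) (fun u _ => (F0P3cStCharTSFH0Kit.isLevel_gH L v 𝓘₂ n' K₁ hK₁o hK₁c u).1) μ hμ
    (fun u => ⟨w₂ * (u.1 : ↥(unitaryGroupOfForm (conjLocal L (IsCMField.complexConj L) v) (cmLocalForm L 2 v))) * w₂⁻¹, weylConj_mem_cmTorus_two L v w₂ hw₂ u.1⟩)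
    (fun u => u.2) d'' hd'' ha'' A
    (fun u => finTau L v (((u.1 : ↥(unitaryGroupOfForm (conjLocal L (IsCMField.complexConj L) v) (cmLocalForm L 2 v))), u.2) :
        ((cmDatum L 2 (Matrix.of fun i j : Fin 2 => if i.val + j.val + 1 = 2 then (1 : L) else 0)).Local v) ×
          ((cmDatum L 1 (Matrix.of fun i j : Fin 1 => if i.val + j.val + 1 = 1 then (1 : L) else 0)).Local v)) μ)
    AG rG rH (fun u _ => F0P3cStCharTSKappaRatio.finTau_weylFlip L v μ w₂ _ u.2) Sn hSn b hrep htr hrH (fun u hu => ?_) hcard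
  rw [← hAH u hu, ← hAG]
  exact hval u hu

include hw in
set_option maxHeartbeats 1600000 in  -- statement-level `whnf` on the CM carriers
/-- **(δ₄) «VALUE AT THE FLIPS», ORIENTED INPUT** — §4 fed with the per-summand traces in the grouping ★ HTR-AT-REPS `htr_at_reps` delivers,
`Tr St_H(ξ_v)(𝟙_{K_H u K_H}) = (A_u · χ_{H,2}(ʷu₁) · χ_{H,2}(u₁)⁻¹) · (χ_{H,2}(u₁) · ψ_v(det u₂))` (`A_u := ν₂(K_{2,n′})·#R₂(u)·ν₁(K₁)·δ_{B₂}^{1∕2}(ʷu₁)` there), regrouped by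
§1 `htr_flip_of_oriented`.  Same conclusion **`Tr St_H(ξ_v)(f^H₀) = A_G · χ_ξ(b)`**. [cite: Rogawski1990, §12.7 Lemma 12.7.3 (proof) p. 195; §12.1 case (1) pp. 171–172] -/
theorem smoothTrace_fH0_eq_mul_cmXiTorusChar_of_oriented
    [MeasurableSpace (((cmDatum L 2 (Matrix.of fun i j : Fin 2 => if i.val + j.val + 1 = 2 then (1 : L) else 0)).Local v) ×
      ((cmDatum L 1 (Matrix.of fun i j : Fin 1 => if i.val + j.val + 1 = 1 then (1 : L) else 0)).Local v))]
    [BorelSpace (((cmDatum L 2 (Matrix.of fun i j : Fin 2 => if i.val + j.val + 1 = 2 then (1 : L) else 0)).Local v) ×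
      ((cmDatum L 1 (Matrix.of fun i j : Fin 1 => if i.val + j.val + 1 = 1 then (1 : L) else 0)).Local v))]
    (νH : Measure (((cmDatum L 2 (Matrix.of fun i j : Fin 2 => if i.val + j.val + 1 = 2 then (1 : L) else 0)).Local v) ×
      ((cmDatum L 1 (Matrix.of fun i j : Fin 1 => if i.val + j.val + 1 = 1 then (1 : L) else 0)).Local v)))
    [νH.IsHaarMeasure] [νH.IsMulRightInvariant]
    (hns : ∀ w : PlacesOver L v, IsCMField.complexConj L • w.1 = w.1) (ξ : OneDimAutRepH L)
    (π₁ πSt : IrrClass (((cmDatum L 2 (Matrix.of fun i j : Fin 2 => if i.val + j.val + 1 = 2 then (1 : L) else 0)).Local v) ×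
      ((cmDatum L 1 (Matrix.of fun i j : Fin 1 => if i.val + j.val + 1 = 1 then (1 : L) else 0)).Local v)))
    (hlab : HLengthTwoLabels L v
      (torusCharPair (conjLocal L (IsCMField.complexConj L) v) (cmLocalForm L 2 v) (cmLocalForm_eq_over L 2 v) 0
        ((torusLocalComponent L (IsCMField.complexConj L) v ξ.η).comp
            (quotConj (conjLocal L (IsCMField.complexConj L) v) (conjLocal_conjLocal_cm L v)) *
          halfModulusChar (UnitaryGroup.LocalRing L v))
        (torusLocalComponent L (IsCMField.complexConj L) v ξ.ψ))
      ((torusLocalComponent L (IsCMField.complexConj L) v ξ.ψ).comp (localDet (IsCMField.complexConj L) v (isUnit_antidiagOne_det L 1))) π₁ πSt)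
    (hπ₁ : ∀ fH : ((cmDatum L 2 (Matrix.of fun i j : Fin 2 => if i.val + j.val + 1 = 2 then (1 : L) else 0)).Local v) ×
        ((cmDatum L 1 (Matrix.of fun i j : Fin 1 => if i.val + j.val + 1 = 1 then (1 : L) else 0)).Local v) → ℂ,
      IsLocSmooth fH → π₁.smoothTrace νH fH = charDist (ξ.xiLocalChar v) νH fH)
    -- the endoscopic character
    (μ : HeckeCharacter L)
    (hμω : ∀ x : Literature.NumberTheory.GaloisRepresentations.ideleGroup ↥(maximalRealSubfield L),
      μ (AdeleRing.ideleBaseChange (↥(maximalRealSubfield L)) L x) = quadraticHeckeCharCM L x)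
    -- the H-shell level `K_H := K_{2,n′} × K₁` and the H-Weyl element `w₂`
    (𝓘₂ : (cmBorelTriple L 2 v).IwahoriDatum) (n' : ℕ)
    (K₁ : Subgroup ((cmDatum L 1 (Matrix.of fun i j : Fin 1 => if i.val + j.val + 1 = 1 then (1 : L) else 0)).Local v))
    (hK₁o : IsOpen (K₁ : Set ((cmDatum L 1 (Matrix.of fun i j : Fin 1 => if i.val + j.val + 1 = 1 then (1 : L) else 0)).Local v)))
    (hK₁c : IsCompact (K₁ : Set ((cmDatum L 1 (Matrix.of fun i j : Fin 1 => if i.val + j.val + 1 = 1 then (1 : L) else 0)).Local v)))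
    (w₂ : ↥(unitaryGroupOfForm (conjLocal L (IsCMField.complexConj L) v) (cmLocalForm L 2 v)))
    (hw₂ : Units.val (w₂ : GL (Fin 2) (LocalRing L v)) = cmLocalForm L 2 v)
    -- the cover `F ⊆ T₂ × U(Φ₁)_v` and ★ REP-HYPERBOLIC's conclusion BY SHAPE
    (F : Finset (↥(cmBorelTriple L 2 v).M × ((cmDatum L 1 (Matrix.of fun i j : Fin 1 => if i.val + j.val + 1 = 1 then (1 : L) else 0)).Local v)))
    (hrepH : ∀ u ∈ F,
      (∃ d' : Fin 2 → (LocalRing L v)ˣ,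
        glDiagonal 2 (LocalRing L v) d' = ((u.1 : ↥(unitaryGroupOfForm (conjLocal L (IsCMField.complexConj L) v) (cmLocalForm L 2 v))) : GL (Fin 2) (LocalRing L v)) ∧
        Valued.v (((d' 1 : (LocalRing L v)ˣ) : LocalRing L v) w) < Valued.v (((d' 0 : (LocalRing L v)ˣ) : LocalRing L v) w) ∧
        galAdicCompletionMap (L := L) (IsCMField.complexConj L) hw (((d' 0 : (LocalRing L v)ˣ) : LocalRing L v) w) * ((d' 1 : (LocalRing L v)ˣ) : LocalRing L v) w = 1) ∧
      (∃ d₀ d₁ : w.1.adicCompletion L,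
        (((localNonsplitEquiv (IsCMField.complexConj L) (Matrix.of fun i j : Fin 2 => if i.val + j.val + 1 = 2 then (1 : L) else 0) (IsCMField.complexConj_ne_one L) w hw
              (u.1 : ↥(unitaryGroupOfForm (conjLocal L (IsCMField.complexConj L) v) (cmLocalForm L 2 v))) :
            ↥(unitaryGroupOfForm (galAdicCompletionMap (L := L) (IsCMField.complexConj L) hw) (placeForm (Matrix.of fun i j : Fin 2 => if i.val + j.val + 1 = 2 then (1 : L) else 0) w.1))) :
            GL (Fin 2) (w.1.adicCompletion L)) : Matrix (Fin 2) (Fin 2) (w.1.adicCompletion L)) = Matrix.diagonal ![d₀, d₁] ∧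
        Valued.v d₁ < Valued.v d₀ ∧ Valued.v d₀ * Valued.v d₁ = 1 ∧ galAdicCompletionMap (L := L) (IsCMField.complexConj L) hw d₀ * d₁ = 1) ∧
      Valued.v (finGammaTwo L v ((u.1 : ↥(unitaryGroupOfForm (conjLocal L (IsCMField.complexConj L) v) (cmLocalForm L 2 v))), u.2) w) = 1)
    -- (R5): `χ_ξ` is trivial on the shell group `S_n ≤ T₃`; the XIG point `b ∈ T₃`; ★ FLIP-REP's conclusion BY SHAPE
    (Sn : Subgroup ↥(cmBorelTriple L 3 v).M)
    (hSn : ∀ t ∈ Sn, cmXiTorusChar L v (μ.semilocalComponent L v) (torusLocalComponent L (IsCMField.complexConj L) v ξ.η)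
      (torusLocalComponent L (IsCMField.complexConj L) v ξ.ψ) t = 1)
    (b : ↥(cmBorelTriple L 3 v).M)
    (hrep : ∀ u ∈ F, ∃ t ∈ b • (Sn : Set ↥(cmBorelTriple L 3 v).M),
      (t : ↥(unitaryGroupOfForm (conjLocal L (IsCMField.complexConj L) v) (cmLocalForm L 3 v))) =
        endoEmbLocal L v
          (((⟨w₂ * (u.1 : ↥(unitaryGroupOfForm (conjLocal L (IsCMField.complexConj L) v) (cmLocalForm L 2 v))) * w₂⁻¹, weylConj_mem_cmTorus_two L v w₂ hw₂ u.1⟩ :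
              ↥(cmBorelTriple L 2 v).M) : ↥(unitaryGroupOfForm (conjLocal L (IsCMField.complexConj L) v) (cmLocalForm L 2 v))), u.2))
    -- the coefficients and the closed-form constants (abstract letters; the head's `hval`, ★ KAPPA-RATIO `hAH ∕ hAG`, ★ HCARD `hcard ∕ hrH`)
    (cj κH A : ↥(cmBorelTriple L 2 v).M × ((cmDatum L 1 (Matrix.of fun i j : Fin 1 => if i.val + j.val + 1 = 1 then (1 : L) else 0)).Local v) → ℂ)
    (κG κ AG rG rH : ℂ)
    (hval : ∀ u ∈ F, cj u * κH u =
      finTau L v (((u.1 : ↥(unitaryGroupOfForm (conjLocal L (IsCMField.complexConj L) v) (cmLocalForm L 2 v))), u.2) :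
        ((cmDatum L 2 (Matrix.of fun i j : Fin 2 => if i.val + j.val + 1 = 2 then (1 : L) else 0)).Local v) ×
          ((cmDatum L 1 (Matrix.of fun i j : Fin 1 => if i.val + j.val + 1 = 1 then (1 : L) else 0)).Local v)) μ * (κG * κ))
    (hAH : ∀ u ∈ F, κH u = A u * rH) (hAG : κG * κ = AG * rG) (hrH : rH ≠ 0) (hcard : (F.card : ℂ) * rG = rH)
    -- the per-summand traces in the ORIENTED grouping of ★ HTR-AT-REPS `htr_at_reps` (verbatim shape, `A u` = its constant prefix)
    (htr : ∀ u ∈ F, πSt.smoothTrace νH ((DoubleCoset.doubleCoset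
        (((u.1 : ↥(unitaryGroupOfForm (conjLocal L (IsCMField.complexConj L) v) (cmLocalForm L 2 v))), u.2) :
          ↥(unitaryGroupOfForm (conjLocal L (IsCMField.complexConj L) v) (cmLocalForm L 2 v)) ×
            (cmDatum L 1 (Matrix.of fun i j : Fin 1 => if i.val + j.val + 1 = 1 then (1 : L) else 0)).Local v)
        (((𝓘₂.K n').prod K₁ : Subgroup (↥(unitaryGroupOfForm (conjLocal L (IsCMField.complexConj L) v) (cmLocalForm L 2 v)) ×
            (cmDatum L 1 (Matrix.of fun i j : Fin 1 => if i.val + j.val + 1 = 1 then (1 : L) else 0)).Local v)) : Set _)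
        ((𝓘₂.K n').prod K₁ : Subgroup (↥(unitaryGroupOfForm (conjLocal L (IsCMField.complexConj L) v) (cmLocalForm L 2 v)) ×
            (cmDatum L 1 (Matrix.of fun i j : Fin 1 => if i.val + j.val + 1 = 1 then (1 : L) else 0)).Local v))).indicator fun _ => (1 : ℂ)) =
      A u * (((torusCharPair (conjLocal L (IsCMField.complexConj L) v) (cmLocalForm L 2 v) (cmLocalForm_eq_over L 2 v) 0
        ((torusLocalComponent L (IsCMField.complexConj L) v ξ.η).comp
            (quotConj (conjLocal L (IsCMField.complexConj L) v) (conjLocal_conjLocal_cm L v)) *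
          halfModulusChar (UnitaryGroup.LocalRing L v))
        (torusLocalComponent L (IsCMField.complexConj L) v ξ.ψ))
          ⟨w₂ * (u.1 : ↥(unitaryGroupOfForm (conjLocal L (IsCMField.complexConj L) v) (cmLocalForm L 2 v))) * w₂⁻¹, weylConj_mem_cmTorus_two L v w₂ hw₂ u.1⟩ : ℂˣ) : ℂ) *
        (((torusCharPair (conjLocal L (IsCMField.complexConj L) v) (cmLocalForm L 2 v) (cmLocalForm_eq_over L 2 v) 0
        ((torusLocalComponent L (IsCMField.complexConj L) v ξ.η).comp
            (quotConj (conjLocal L (IsCMField.complexConj L) v) (conjLocal_conjLocal_cm L v)) *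
          halfModulusChar (UnitaryGroup.LocalRing L v))
        (torusLocalComponent L (IsCMField.complexConj L) v ξ.ψ)) u.1 : ℂˣ) : ℂ)⁻¹ *
        ((((torusCharPair (conjLocal L (IsCMField.complexConj L) v) (cmLocalForm L 2 v) (cmLocalForm_eq_over L 2 v) 0
        ((torusLocalComponent L (IsCMField.complexConj L) v ξ.η).comp
            (quotConj (conjLocal L (IsCMField.complexConj L) v) (conjLocal_conjLocal_cm L v)) *
          halfModulusChar (UnitaryGroup.LocalRing L v))
        (torusLocalComponent L (IsCMField.complexConj L) v ξ.ψ)) u.1 : ℂˣ) : ℂ) *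
          ((((torusLocalComponent L (IsCMField.complexConj L) v ξ.ψ).comp (localDet (IsCMField.complexConj L) v (isUnit_antidiagOne_det L 1))) u.2 : ℂˣ) : ℂ))) :
    πSt.smoothTrace νH (∑ u ∈ F, cj u • (DoubleCoset.doubleCoset
        (((u.1 : ↥(unitaryGroupOfForm (conjLocal L (IsCMField.complexConj L) v) (cmLocalForm L 2 v))), u.2) :
          ↥(unitaryGroupOfForm (conjLocal L (IsCMField.complexConj L) v) (cmLocalForm L 2 v)) ×
            (cmDatum L 1 (Matrix.of fun i j : Fin 1 => if i.val + j.val + 1 = 1 then (1 : L) else 0)).Local v)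
        (((𝓘₂.K n').prod K₁ : Subgroup (↥(unitaryGroupOfForm (conjLocal L (IsCMField.complexConj L) v) (cmLocalForm L 2 v)) ×
            (cmDatum L 1 (Matrix.of fun i j : Fin 1 => if i.val + j.val + 1 = 1 then (1 : L) else 0)).Local v)) : Set _)
        ((𝓘₂.K n').prod K₁ : Subgroup (↥(unitaryGroupOfForm (conjLocal L (IsCMField.complexConj L) v) (cmLocalForm L 2 v)) ×
            (cmDatum L 1 (Matrix.of fun i j : Fin 1 => if i.val + j.val + 1 = 1 then (1 : L) else 0)).Local v))).indicator fun _ => (1 : ℂ)) =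
      AG * ((cmXiTorusChar L v (μ.semilocalComponent L v) (torusLocalComponent L (IsCMField.complexConj L) v ξ.η)
        (torusLocalComponent L (IsCMField.complexConj L) v ξ.ψ) b : ℂˣ) : ℂ) :=
  smoothTrace_fH0_eq_mul_cmXiTorusChar L v w hw νH hns ξ π₁ πSt hlab hπ₁ μ hμω 𝓘₂ n' K₁ hK₁o hK₁c w₂ hw₂ F hrepH Sn hSn b hrep cj κH A κG κ AG rG rH
    hval hAH hAG hrH hcard (htr_flip_of_oriented F _ A _ _ _ htr)

end CM

end Summit.HodgeConjecture.HodgeConjecture.Cruxes.H413.F0P3cStCharTSValueAtFlips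

end
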